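import Mathlib
import Summits.ResolutionOfSingularities.ResolutionOfSingularities.Theorems.HomologicalConductorPersistenceQuotientAscent
import Summits.ResolutionOfSingularities.ResolutionOfSingularities.Theorems.HomologicalConductorPersistenceConductorStable
import Summits.ResolutionOfSingularities.ResolutionOfSingularities.Theorems.HomologicalConductorPersistenceKC3LowerCurve
import Literature.RingTheory.CohomologyAnnihilator.Localization
import HarnessLib

/-!
# Crux `Persistence` (stmt-ResolutionOfSingularities-16484), chain W4.4b — K-C3 K2-LOWER, part 4a/4:
# the MIDDLE STAGE `B = k[x,z,t]/(x² − z³ − t⁴)`: `t̄², z̄t̄, z̄² ∈ ca³(B)` fact-free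

Route `ResolutionOfSingularities/HomologicalConductor`, chain W4.4b (cell `res-hironaka`), crux `Persistence`
(stmt-ResolutionOfSingularities-16484), KILL CANDIDATE K-C3 (CHAIN w44b v13.3 §V13.11), item K2.  `[OURS · L1 w44b]`; NOT a
statement of the manuscript under review (Hironaka 2017), no statement of that manuscript is used; AI-written, weaker
than expert review.

* §0 tools: `mk_mem_nonZeroDivisors_of_ringHom` (regularity of `a` mod `f` from regularity of `f` mod `a` along a ring
  map killing exactly `(a)`); `mem_cohomologyAnnihilatorOfDegree_of_surjective` (part 1's quotient ascent transported
  along a SURJECTION with kernel `(a)`, so that tower stages may be PRESENTED).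
* §1 curve stage: `t̄², z̄t̄, z̄² ∈ ca²((k[x,z,t]/(x² − z³ − t⁴))/(x̄))` (part 3's injective `ψ` into `k[τ]` with image
  `⊇ τ⁶k[τ]` + part 2's «conductor ⊆ ca²»).
* §2 middle stage: `x̄ ∈ B⁰` (`F′ ≡ −(z³ + t⁴) mod x`), `x̄ ∈ ca³(B)` (`∂F′/∂x = 2x`, KEPT-PROPER p522421, `2 ≠ 0`),
  quotient ascent ⇒ **`t̄², z̄t̄, z̄² ∈ ca³(B)`**.
The first stage `A = k[x,y,z,t]/(xy − z³ − t⁴)` and the two-sided equality are part 4b (`…PersistenceKC3Lower`).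

References (mechanism only): res-L1-w44b-plan-1 CHAIN w44b v13.3; res-type-010 p527657/p528919; res-D-pv-058 p522421
(all OURS); H. Knörrer, Invent. Math. 88 (1987); Ö. Esentepe, J. Algebra 541 (2020) [`Esentepe2020`].
-/

noncomputable section

-- single-problem summit: the doubled namespace component `ResolutionOfSingularities` is forced
set_option linter.dupNamespace false

namespace Summit.ResolutionOfSingularities.ResolutionOfSingularities.Theorems.HomologicalConductor.KC3Lower

open MvPolynomial Literature.RingTheory.CohomologyAnnihilator
open Summit.ResolutionOfSingularities.ResolutionOfSingularities.Theorems.HomologicalConductor.PersistenceJacobianKept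
open Summit.ResolutionOfSingularities.ResolutionOfSingularities.Theorems.HomologicalConductor.QuotientAscent
open Summit.ResolutionOfSingularities.ResolutionOfSingularities.Theorems.HomologicalConductor.ConductorStable
open scoped nonZeroDivisors

universe u

/-! ## §0 Regularity modulo `f` from regularity of `f` modulo `a` -/

/-- **Regularity transfer.** `σ : S → T` a ring map with `σ a = 0` and `ker σ ⊆ (a)` (i.e. `ker σ = (a)`), `a ∈ S⁰`,
and `σ f` a non-zero-divisor of `T`.  Then the class of `a` is a non-zero-divisor of `S/(f)`:
`g a = f q ⇒ σ f · σ q = 0 ⇒ σ q = 0 ⇒ q = a q₁ ⇒ g = f q₁`. [folklore] -/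
theorem mk_mem_nonZeroDivisors_of_ringHom {S T : Type*} [CommRing S] [CommRing T] (σ : S →+* T) {a f : S}
    (ha : a ∈ S⁰) (hσa : σ a = 0) (hker : ∀ q : S, σ q = 0 → a ∣ q) (hσf : σ f ∈ T⁰) :
    Ideal.Quotient.mk (Ideal.span ({f} : Set S)) a ∈ (S ⧸ Ideal.span ({f} : Set S))⁰ := by
  rw [mem_nonZeroDivisors_iff_right]
  intro u hu
  obtain ⟨g, rfl⟩ := Ideal.Quotient.mk_surjective u
  rw [← map_mul, Ideal.Quotient.eq_zero_iff_mem, Ideal.mem_span_singleton] at hu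
  obtain ⟨q, hq⟩ := hu
  have hσq : σ q = 0 := by
    have h := congrArg σ hq
    rw [map_mul, map_mul, hσa, mul_zero] at h
    exact (mem_nonZeroDivisors_iff_right.mp hσf) _ (by rw [mul_comm]; exact h.symm)
  obtain ⟨q₁, rfl⟩ := hker q hσq
  rw [Ideal.Quotient.eq_zero_iff_mem, Ideal.mem_span_singleton]
  have hzero : g - f * q₁ = 0 :=
    (mem_nonZeroDivisors_iff_right.mp ha) _ (by rw [sub_mul, sub_eq_zero, hq]; ring)
  exact ⟨q₁, sub_eq_zero.mp hzero⟩

/-- **Quotient ascent along a surjection** (part 1's `QuotientAscent.mem_cohomologyAnnihilatorOfDegree_of_mk_mem`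
transported along `R ⧸ (a) ≃ R′` for any surjective `π : R → R′` with `ker π = (a)`): `a ∈ R⁰ ∩ caᵐ⁺²(R)`,
`π c ∈ caᵐ⁺¹(R′)` ⇒ `c ∈ caᵐ⁺²(R)`.  (Lets a tower stage be PRESENTED, e.g. `k[x,y,z,t]/(xy − h) ↠ k[x,z,t]/(x² − h)`,
instead of taken as an iterated quotient.) [OURS · L1 w44b] -/
theorem mem_cohomologyAnnihilatorOfDegree_of_surjective {R : Type u} [CommRing R] [IsNoetherianRing R]
    {R' : Type u} [CommRing R'] (π : R →+* R') (hπ : Function.Surjective π) {a : R}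
    (hker : RingHom.ker π = Ideal.span {a}) (ha : a ∈ R⁰) {m : ℕ}
    (haca : a ∈ cohomologyAnnihilatorOfDegree R (m + 2)) {c : R}
    (hc : π c ∈ cohomologyAnnihilatorOfDegree R' (m + 1)) :
    c ∈ cohomologyAnnihilatorOfDegree R (m + 2) := by
  let e : R ⧸ Ideal.span {a} ≃+* R' :=
    (Ideal.quotEquivOfEq hker.symm).trans (RingHom.quotientKerEquivOfSurjective hπ)
  have he : e (Ideal.Quotient.mk (Ideal.span {a}) c) = π c := by
    simp [e, Ideal.quotEquivOfEq_mk, RingHom.quotientKerEquivOfSurjective_apply_mk]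
  have hc' : e.symm (π c) ∈ cohomologyAnnihilatorOfDegree (R ⧸ Ideal.span {a}) (m + 1) :=
    ringEquiv_apply_mem_cohomologyAnnihilatorOfDegree e.symm hc
  rw [← he, e.symm_apply_apply] at hc'
  exact mem_cohomologyAnnihilatorOfDegree_of_mk_mem ha haca hc'

section Tower

variable (k : Type u) [Field k]

/-! ## §1 The curve stage: `t̄², z̄t̄, z̄² ∈ ca²(C₂)`, `C₂ = (k[x,z,t]/(x² − z³ − t⁴))/(x̄)` -/

/-- `t̄², z̄t̄, z̄² ∈ ca²((k[x,z,t]/(x² − z³ − t⁴))/(x̄))` — conductor `⊆ ca²` at the `E₆` curve (parts 2 and 3).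
[OURS · L1 w44b] -/
theorem mem_cohomologyAnnihilatorOfDegree_two_curveStage (F : MvPolynomial (Fin 3) k)
    (hF : F = X 0 ^ 2 - X 1 ^ 3 - X 2 ^ 4)
    (a₁ : MvPolynomial (Fin 3) k ⧸ Ideal.span ({F} : Set (MvPolynomial (Fin 3) k)))
    (ha₁ : a₁ = Ideal.Quotient.mk _ (X 0)) (c : MvPolynomial (Fin 3) k)
    (hc : c = X 2 ^ 2 ∨ c = X 1 * X 2 ∨ c = X 1 ^ 2) :
    Ideal.Quotient.mk (Ideal.span {a₁}) (Ideal.Quotient.mk _ c) ∈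
      cohomologyAnnihilatorOfDegree
        ((MvPolynomial (Fin 3) k ⧸ Ideal.span ({F} : Set (MvPolynomial (Fin 3) k))) ⧸ Ideal.span {a₁}) 2 := by
  obtain ⟨ψ, hinj, hψ, himg⟩ := exists_ringHom_curveStage k F hF a₁ ha₁
  refine mem_cohomologyAnnihilatorOfDegree_two_of_conductor_ringHom ψ hinj fun d => ?_
  -- `ψ c ∈ {τ⁶, −τ⁷, τ⁸}`, so `ψ c · d ∈ τ⁶ · k[τ] ⊆ ψ(C₂)`
  have hval : ∃ e : Polynomial k, ψ (Ideal.Quotient.mk (Ideal.span {a₁}) (Ideal.Quotient.mk _ c)) =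
      Polynomial.X ^ 6 * e := by
    rw [hψ]
    rcases hc with rfl | rfl | rfl
    · exact ⟨1, by simp; ring⟩
    · exact ⟨-Polynomial.X, by simp; ring⟩
    · exact ⟨Polynomial.X ^ 2, by simp; ring⟩
  obtain ⟨e, he⟩ := hval
  obtain ⟨c', hc'⟩ := himg (e * d)
  exact ⟨c', by rw [hc', he, mul_assoc]⟩

/-! ## §2 The middle stage `B = k[x,z,t]/(x² − z³ − t⁴)`: `x̄ ∈ B⁰ ∩ ca³(B)`, ascent to `ca³(B)` -/

/-- `x² − z³ − t⁴ ≠ 0` (evaluate at `(1,0,0)`). [folklore] -/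
theorem F'_ne_zero : (X 0 ^ 2 - X 1 ^ 3 - X 2 ^ 4 : MvPolynomial (Fin 3) k) ≠ 0 := by
  intro h
  have h' := congrArg (MvPolynomial.eval (![1, 0, 0] : Fin 3 → k)) h
  simp at h'

/-- `x̄` is a non-zero-divisor of `B = k[x,z,t]/(x² − z³ − t⁴)` (`F′ ≡ −(z³ + t⁴) ≠ 0 mod x`). [folklore] -/
theorem mk_X0_mem_nonZeroDivisors_middleStage :
    Ideal.Quotient.mk (Ideal.span ({X 0 ^ 2 - X 1 ^ 3 - X 2 ^ 4} : Set (MvPolynomial (Fin 3) k))) (X 0) ∈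
      (MvPolynomial (Fin 3) k ⧸ Ideal.span ({X 0 ^ 2 - X 1 ^ 3 - X 2 ^ 4} : Set (MvPolynomial (Fin 3) k)))⁰ := by
  refine mk_mem_nonZeroDivisors_of_ringHom
    (MvPolynomial.aeval (![0, X 0, X 1] : Fin 3 → MvPolynomial (Fin 2) k)).toRingHom
    (mem_nonZeroDivisors_of_ne_zero (MvPolynomial.X_ne_zero 0)) (by simp) (fun q hq => ?_) ?_
  · have h := sub_inclusion_retraction_mem₃ k q
    rw [AlgHom.toRingHom_eq_coe, RingHom.coe_coe] at hq
    rw [hq, map_zero, sub_zero] at h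
    exact Ideal.mem_span_singleton.mp h
  · refine mem_nonZeroDivisors_of_ne_zero ?_
    intro h
    have h' := congrArg (MvPolynomial.eval (![1, 0] : Fin 2 → k)) h
    simp at h'

/-- `x̄ ∈ ca³(B)`, `B = k[x,z,t]/(x² − z³ − t⁴)`, when `2 ≠ 0` in `k` (`∂F′/∂x = 2x`, KEPT-PROPER). [folklore] -/
theorem mk_X0_mem_cohomologyAnnihilatorOfDegree_three_middleStage (h2 : (2 : k) ≠ 0) :
    Ideal.Quotient.mk (Ideal.span ({X 0 ^ 2 - X 1 ^ 3 - X 2 ^ 4} : Set (MvPolynomial (Fin 3) k))) (X 0) ∈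
      cohomologyAnnihilatorOfDegree
        (MvPolynomial (Fin 3) k ⧸ Ideal.span ({X 0 ^ 2 - X 1 ^ 3 - X 2 ^ 4} : Set (MvPolynomial (Fin 3) k))) 3 := by
  have hped : MvPolynomial.pderiv 0 (X 0 ^ 2 - X 1 ^ 3 - X 2 ^ 4 : MvPolynomial (Fin 3) k) = C 2 * X 0 := by
    simp [map_sub, Derivation.leibniz_pow, MvPolynomial.pderiv_X, map_ofNat]
  have h : Ideal.Quotient.mk (Ideal.span ({X 0 ^ 2 - X 1 ^ 3 - X 2 ^ 4} : Set (MvPolynomial (Fin 3) k)))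
      (MvPolynomial.pderiv 0 (X 0 ^ 2 - X 1 ^ 3 - X 2 ^ 4 : MvPolynomial (Fin 3) k)) ∈
      cohomologyAnnihilatorOfDegree
        (MvPolynomial (Fin 3) k ⧸ Ideal.span ({X 0 ^ 2 - X 1 ^ 3 - X 2 ^ 4} : Set (MvPolynomial (Fin 3) k))) 3 :=
    pderiv_mem_cohomologyAnnihilatorOfDegree (d := 2)
      (X 0 ^ 2 - X 1 ^ 3 - X 2 ^ 4 : MvPolynomial (Fin 3) k) (F'_ne_zero k) 0
  rw [hped] at h
  have hmem : Ideal.Quotient.mk (Ideal.span ({X 0 ^ 2 - X 1 ^ 3 - X 2 ^ 4} : Set (MvPolynomial (Fin 3) k)))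
      (C (2⁻¹) * (C 2 * X 0)) ∈
      cohomologyAnnihilatorOfDegree
        (MvPolynomial (Fin 3) k ⧸ Ideal.span ({X 0 ^ 2 - X 1 ^ 3 - X 2 ^ 4} : Set (MvPolynomial (Fin 3) k))) 3 := by
    rw [map_mul]
    exact Ideal.mul_mem_left _ _ h
  have hX : (C (2⁻¹) * (C 2 * X 0) : MvPolynomial (Fin 3) k) = X 0 := by
    rw [← mul_assoc, ← C_mul, inv_mul_cancel₀ h2, C_1, one_mul]
  rwa [hX] at hmem

/-- **Middle stage**: `t̄², z̄t̄, z̄² ∈ ca³(k[x,z,t]/(x² − z³ − t⁴))` (`2 ≠ 0` in `k`) — quotient ascent along `x̄`.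
[OURS · L1 w44b] -/
theorem mem_cohomologyAnnihilatorOfDegree_three_middleStage (h2 : (2 : k) ≠ 0) (c : MvPolynomial (Fin 3) k)
    (hc : c = X 2 ^ 2 ∨ c = X 1 * X 2 ∨ c = X 1 ^ 2) :
    Ideal.Quotient.mk (Ideal.span ({X 0 ^ 2 - X 1 ^ 3 - X 2 ^ 4} : Set (MvPolynomial (Fin 3) k))) c ∈
      cohomologyAnnihilatorOfDegree
        (MvPolynomial (Fin 3) k ⧸ Ideal.span ({X 0 ^ 2 - X 1 ^ 3 - X 2 ^ 4} : Set (MvPolynomial (Fin 3) k))) 3 :=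
  mem_cohomologyAnnihilatorOfDegree_of_mk_mem (m := 1) (mk_X0_mem_nonZeroDivisors_middleStage k)
    (mk_X0_mem_cohomologyAnnihilatorOfDegree_three_middleStage k h2)
    (mem_cohomologyAnnihilatorOfDegree_two_curveStage k _ rfl _ rfl c hc)

end Tower

end Summit.ResolutionOfSingularities.ResolutionOfSingularities.Theorems.HomologicalConductor.KC3Lower

end
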